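import Literature.AlgebraicTopology.Homotopy.MappingTelescope
import Literature.AlgebraicTopology.Homotopy.CWComplexTransfer
import Mathlib.Topology.CWComplex.Classical.Finite
import HarnessLib

/-!
# Cells of the mapping telescope of a self-map of a CW complex

Topic `Literature/AlgebraicTopology/Homotopy` (sub-namespace `Telescope`), continuing
`MappingTelescope.lean`. For a compact `K ⊆ E` whose subtype `↥K` carries a classical CW
structure (`Topology.CWComplex (univ : Set ↥K)`, e.g. the lattice cube complexes of
`Literature/Topology/Euclidean/LatticeCubeComplex.lean`) and a self-map `g` of `K`, the mapping
telescope `Telescope.space g K ⊆ E × E × ℝ` has two kinds of cells over each level `k`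
(Hatcher, *Algebraic Topology* (2002), proof of Prop. A.11, p. 528: "`T(f, f, ⋯)` … is a CW
complex" when `f` is cellular; the cells are those of `∐ₖ X × [k, k + 1]`):

* **vertical cells** `Telescope.vmap k n c`: the cell `c` of `K` placed at height `k`,
  `w ↦ (Φ_c w, 0, k)`;
* **horizontal cells** `Telescope.hzmap k n c` of dimension `n + 1`: the product of the cell
  `c` (dimension `n`) with the open interval of heights `(k, k + 1)`,
  `w ↦ emb g k (Φ_c (init w)) ((1 + w_last) / 2)`.

This file constructs these characteristic maps as `PartialEquiv`s with the continuity
properties Mathlib's `Topology.CWComplex` asks for, and computes their open / closed cells.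
The CW structure itself (disjointness, closure finiteness — which needs `g` cellular — and the
weak topology) is assembled in `MappingTelescopeCWComplex.lean`. No `sorry`; [folklore].

## References

* A. Hatcher, *Algebraic Topology*, CUP (2002), Appendix, proof of Prop. A.11 (p. 528);
  pp. 519–521 (product cells). [HatcherAT2002]
-/

noncomputable section

open Set Function Topology Metric Filter

namespace Literature.AlgebraicTopology.Homotopy

namespace Telescope

/-! ### Splitting `Fin (n + 1) → ℝ` as `(Fin n → ℝ) × ℝ` in the sup norm -/

section Snoc

variable {n : ℕ}

/-- The sup norm of `Fin.snoc v t` is `max ‖v‖ |t|`. [folklore] -/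
theorem norm_snoc (v : Fin n → ℝ) (t : ℝ) : ‖(Fin.snoc v t : Fin (n + 1) → ℝ)‖ = max ‖v‖ ‖t‖ := by
  refine le_antisymm ?_ (max_le ?_ ?_)
  · refine (pi_norm_le_iff_of_nonneg (le_max_of_le_left (norm_nonneg v))).2 fun i => ?_
    refine Fin.lastCases ?_ (fun j => ?_) i
    · rw [Fin.snoc_last]
      exact le_max_right _ _
    · rw [Fin.snoc_castSucc]
      exact (norm_le_pi_norm v j).trans (le_max_left _ _)
  · refine (pi_norm_le_iff_of_nonneg (norm_nonneg _)).2 fun j => ?_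
    have := norm_le_pi_norm (Fin.snoc v t : Fin (n + 1) → ℝ) j.castSucc
    rwa [Fin.snoc_castSucc] at this
  · have := norm_le_pi_norm (Fin.snoc v t : Fin (n + 1) → ℝ) (Fin.last n)
    rwa [Fin.snoc_last] at this

/-- The sup norm of `w` is `max ‖init w‖ |w_last|`. [folklore] -/
theorem norm_eq_max_init_last (w : Fin (n + 1) → ℝ) :
    ‖w‖ = max ‖Fin.init w‖ ‖w (Fin.last n)‖ := by
  conv_lhs => rw [← Fin.snoc_init_self w]
  exact norm_snoc _ _

/-- `init` does not increase the sup norm. [folklore] -/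
theorem norm_init_le (w : Fin (n + 1) → ℝ) : ‖Fin.init w‖ ≤ ‖w‖ := by
  rw [norm_eq_max_init_last]
  exact le_max_left _ _

/-- The last coordinate is bounded by the sup norm. [folklore] -/
theorem abs_last_le (w : Fin (n + 1) → ℝ) : |w (Fin.last n)| ≤ ‖w‖ := by
  rw [← Real.norm_eq_abs]
  exact norm_le_pi_norm w _

/-- `Fin.snoc` is continuous in `(v, t)`. [folklore] -/
theorem continuous_snoc :
    Continuous fun p : (Fin n → ℝ) × ℝ => (Fin.snoc p.1 p.2 : Fin (n + 1) → ℝ) :=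
  Continuous.finSnoc (A := fun _ : Fin (n + 1) => ℝ) continuous_fst continuous_snd

/-- `Fin.init` is continuous. [folklore] -/
theorem continuous_init : Continuous fun w : Fin (n + 1) → ℝ => Fin.init w :=
  continuous_id.finInit

end Snoc

/-! ### The setting: a CW structure on `↥K` and a self-map `g` of `K` -/

universe u

variable {E : Type u} [NormedAddCommGroup E] {K : Set E} [Topology.CWComplex (univ : Set ↥K)]

/-- The characteristic map of the cell `c` of `↥K`, with values in `E`. [folklore] -/
def chart (n : ℕ) (c : RelCWComplex.cell (univ : Set ↥K) n) (w : Fin n → ℝ) : E :=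
  ((RelCWComplex.map n c w : ↥K) : E)

/-- The chart takes values in `K`. [folklore] -/
theorem chart_mem (n : ℕ) (c : RelCWComplex.cell (univ : Set ↥K) n) (w : Fin n → ℝ) :
    chart n c w ∈ K := (RelCWComplex.map n c w).2

/-- The chart is continuous on the closed ball. [folklore] -/
theorem continuousOn_chart (n : ℕ) (c : RelCWComplex.cell (univ : Set ↥K) n) :
    ContinuousOn (chart n c) (closedBall 0 1) :=
  continuous_subtype_val.comp_continuousOn (RelCWComplex.continuousOn n c)

/-- The chart, as a subtype element, on the closed ball. [folklore] -/
theorem toSubtype_chart (n : ℕ) (c : RelCWComplex.cell (univ : Set ↥K) n) (z₀ : ↥K)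
    (w : Fin n → ℝ) : CWTransfer.toSubtype z₀ (chart n c w) = RelCWComplex.map n c w :=
  CWTransfer.toSubtype_coe z₀ _

/-- Images of the chart: `chart '' A = val '' (map '' A)`. [folklore] -/
theorem image_chart (n : ℕ) (c : RelCWComplex.cell (univ : Set ↥K) n) (A : Set (Fin n → ℝ)) :
    chart n c '' A = Subtype.val '' (RelCWComplex.map n c '' A) := by
  rw [image_image]
  rfl

/-! ### Vertical cells -/

section Vertical

variable (k : ℕ) (n : ℕ) (c : RelCWComplex.cell (univ : Set ↥K) n)

/-- The vertical cell map `w ↦ (Φ_c w, 0, k)`. [folklore] -/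
def vfun (w : Fin n → ℝ) : E × E × ℝ := (chart n c w, 0, (k : ℝ))

/-- The vertical cell map is `emb g k (Φ_c w) 0`. [folklore] -/
theorem vfun_eq_emb [NormedSpace ℝ E] (g : E → E) (w : Fin n → ℝ) :
    vfun k n c w = emb g k (chart n c w) 0 := by
  rw [emb_zero]
  rfl

/-- The inverse of the vertical cell map. [folklore] -/
def vinv (p : E × E × ℝ) : Fin n → ℝ :=
  (RelCWComplex.map n c).symm (CWTransfer.toSubtype (RelCWComplex.map n c 0) p.1)

/-- `vinv ∘ vfun = id` on the open ball. [folklore] -/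
theorem vinv_vfun {w : Fin n → ℝ} (hw : w ∈ ball (0 : Fin n → ℝ) 1) : vinv n c (vfun k n c w) = w := by
  simp only [vinv, vfun, toSubtype_chart]
  exact (RelCWComplex.map n c).left_inv (by rw [RelCWComplex.source_eq]; exact hw)

/-- **The vertical cell** over level `k` built on the cell `c` of `K`: a partial equivalence
between the open ball and its image. [folklore] -/
def vmap : PartialEquiv (Fin n → ℝ) (E × E × ℝ) where
  toFun := vfun k n c
  invFun := vinv n c
  source := ball 0 1
  target := vfun k n c '' ball 0 1
  map_source' w hw := mem_image_of_mem _ hw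
  map_target' := by
    rintro _ ⟨w, hw, rfl⟩
    rw [vinv_vfun k n c hw]
    exact hw
  left_inv' w hw := vinv_vfun k n c hw
  right_inv' := by
    rintro _ ⟨w, hw, rfl⟩
    rw [vinv_vfun k n c hw]

/-- The vertical cell map, unfolded. [folklore] -/
@[simp]
theorem vmap_apply (w : Fin n → ℝ) : vmap k n c w = (chart n c w, 0, (k : ℝ)) := rfl

/-- The source of the vertical cell map. [folklore] -/
theorem vmap_source : (vmap k n c).source = ball 0 1 := rfl

/-- The vertical cell map is continuous. [folklore] -/
theorem continuousOn_vmap : ContinuousOn (vmap k n c) (closedBall 0 1) :=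
  (continuousOn_chart n c).prodMk (continuousOn_const.prodMk continuousOn_const)

/-- The inverse of the vertical cell map is continuous on the open cell. [folklore] -/
theorem continuousOn_vmap_symm : ContinuousOn (vmap k n c).symm (vmap k n c).target := by
  show ContinuousOn (vinv n c) (vfun k n c '' ball 0 1)
  have h1 : MapsTo (fun p : E × E × ℝ => CWTransfer.toSubtype (RelCWComplex.map n c 0) p.1)
      (vfun k n c '' ball 0 1) (RelCWComplex.map n c).target := by
    rintro _ ⟨w, hw, rfl⟩
    simp only [vfun, toSubtype_chart]
    exact (RelCWComplex.map n c).map_source (by rw [RelCWComplex.source_eq]; exact hw)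
  refine (RelCWComplex.continuousOn_symm n c).comp ?_ h1
  refine (CWTransfer.continuousOn_toSubtype _).comp continuousOn_fst ?_
  rintro _ ⟨w, hw, rfl⟩
  exact chart_mem n c w

/-- Images of the vertical cell map: `{(x, 0, k) | x ∈ Φ_c(A)}`. [folklore] -/
theorem image_vmap (A : Set (Fin n → ℝ)) :
    vmap k n c '' A = (fun x : E => ((x, 0, (k : ℝ)) : E × E × ℝ)) '' (chart n c '' A) := by
  rw [image_image]
  rfl

/-- Points of the images of the vertical cell map. [folklore] -/
theorem mem_image_vmap {A : Set (Fin n → ℝ)} {p : E × E × ℝ} :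
    p ∈ vmap k n c '' A ↔ ∃ w ∈ A, (chart n c w, (0 : E), (k : ℝ)) = p := by
  rfl

end Vertical

variable [NormedSpace ℝ E]

/-! ### Horizontal cells -/

section Horizontal

variable (g : E → E) (k : ℕ) (n : ℕ) (c : RelCWComplex.cell (univ : Set ↥K) n)

/-- The height parameter `s = (1 + t) / 2 ∈ [0, 1]` of the last coordinate `t ∈ [-1, 1]`.
[folklore] -/
def hgt (w : Fin (n + 1) → ℝ) : ℝ := (1 + w (Fin.last n)) / 2

/-- The horizontal cell map `w ↦ emb g k (Φ_c (init w)) ((1 + w_last) / 2)`. [folklore] -/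
def hfun (w : Fin (n + 1) → ℝ) : E × E × ℝ := emb g k (chart n c (Fin.init w)) (hgt n w)

/-- The height parameter of a telescope point over level `k`. [folklore] -/
def lpar (p : E × E × ℝ) : ℝ := p.2.2 - k

/-- The inverse of the horizontal cell map (valid on the open cell). [folklore] -/
def hinv (p : E × E × ℝ) : Fin (n + 1) → ℝ :=
  Fin.snoc ((RelCWComplex.map n c).symm (CWTransfer.toSubtype (RelCWComplex.map n c 0)
    ((lpar k p * (1 - lpar k p))⁻¹ • p.2.1))) (2 * lpar k p - 1)

/-- On the open ball, `init` lies in the open ball and the height in `(0, 1)`. [folklore] -/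
theorem init_mem_ball_and_hgt {w : Fin (n + 1) → ℝ} (hw : w ∈ ball (0 : Fin (n + 1) → ℝ) 1) :
    Fin.init w ∈ ball (0 : Fin n → ℝ) 1 ∧ hgt n w ∈ Ioo (0 : ℝ) 1 := by
  rw [mem_ball_zero_iff] at hw
  refine ⟨mem_ball_zero_iff.2 ((norm_init_le w).trans_lt hw), ?_⟩
  have h := (abs_last_le w).trans_lt hw
  rw [abs_lt] at h
  simp only [hgt, mem_Ioo]
  constructor <;> linarith [h.1, h.2]

/-- On the closed ball, `init` lies in the closed ball and the height in `[0, 1]`. [folklore] -/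
theorem init_mem_closedBall_and_hgt {w : Fin (n + 1) → ℝ}
    (hw : w ∈ closedBall (0 : Fin (n + 1) → ℝ) 1) :
    Fin.init w ∈ closedBall (0 : Fin n → ℝ) 1 ∧ hgt n w ∈ Icc (0 : ℝ) 1 := by
  rw [mem_closedBall_zero_iff] at hw
  refine ⟨mem_closedBall_zero_iff.2 ((norm_init_le w).trans hw), ?_⟩
  have h := (abs_last_le w).trans hw
  rw [abs_le] at h
  simp only [hgt, mem_Icc]
  constructor <;> linarith [h.1, h.2]

/-- `hinv ∘ hfun = id` on the open ball. [folklore] -/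
theorem hinv_hfun {w : Fin (n + 1) → ℝ} (hw : w ∈ ball (0 : Fin (n + 1) → ℝ) 1) :
    hinv k n c (hfun g k n c w) = w := by
  obtain ⟨hi, hs⟩ := init_mem_ball_and_hgt n hw
  have hpar : lpar k (hfun g k n c w) = hgt n w := by
    simp [lpar, hfun, emb_height]
  have hne : hgt n w * (1 - hgt n w) ≠ 0 := mul_ne_zero hs.1.ne' (by linarith [hs.2])
  have hx : (lpar k (hfun g k n c w) * (1 - lpar k (hfun g k n c w)))⁻¹ • (hfun g k n c w).2.1 =
      chart n c (Fin.init w) := by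
    rw [hpar]
    simp only [hfun, emb]
    rw [smul_smul, inv_mul_cancel₀ hne, one_smul]
  unfold hinv
  rw [hx, toSubtype_chart, (RelCWComplex.map n c).left_inv
    (by rw [RelCWComplex.source_eq]; exact hi), hpar]
  have ht : 2 * hgt n w - 1 = w (Fin.last n) := by
    simp only [hgt]
    ring
  rw [ht, Fin.snoc_init_self]

/-- **The horizontal cell** over level `k` built on the cell `c` of `K` (dimension `n + 1`): a
partial equivalence between the open ball of `Fin (n + 1) → ℝ` and its image. [folklore] -/
def hzmap : PartialEquiv (Fin (n + 1) → ℝ) (E × E × ℝ) where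
  toFun := hfun g k n c
  invFun := hinv k n c
  source := ball 0 1
  target := hfun g k n c '' ball 0 1
  map_source' w hw := mem_image_of_mem _ hw
  map_target' := by
    rintro _ ⟨w, hw, rfl⟩
    rw [hinv_hfun g k n c hw]
    exact hw
  left_inv' w hw := hinv_hfun g k n c hw
  right_inv' := by
    rintro _ ⟨w, hw, rfl⟩
    rw [hinv_hfun g k n c hw]

/-- The horizontal cell map, unfolded. [folklore] -/
@[simp]
theorem hzmap_apply (w : Fin (n + 1) → ℝ) :
    hzmap g k n c w = emb g k (chart n c (Fin.init w)) (hgt n w) := rfl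

/-- The source of the horizontal cell map. [folklore] -/
theorem hzmap_source : (hzmap g k n c).source = ball 0 1 := rfl

variable {g}

/-- The horizontal cell map is continuous on the closed ball (for `g` continuous on `K`).
[folklore] -/
theorem continuousOn_hzmap (hg : ContinuousOn g K) : ContinuousOn (hzmap g k n c) (closedBall 0 1) := by
  show ContinuousOn (hfun g k n c) (closedBall 0 1)
  have h1 : ContinuousOn (fun w : Fin (n + 1) → ℝ => (chart n c (Fin.init w), hgt n w))
      (closedBall 0 1) := by
    refine ContinuousOn.prodMk ?_ ?_
    · exact (continuousOn_chart n c).comp continuous_init.continuousOn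
        fun w hw => (init_mem_closedBall_and_hgt n hw).1
    · exact (by unfold hgt; fun_prop : Continuous fun w : Fin (n + 1) → ℝ => hgt n w).continuousOn
  exact (continuousOn_emb hg k).comp h1 fun w _ => ⟨chart_mem n c _, mem_univ _⟩

/-- The inverse of the horizontal cell map is continuous on the open cell. [folklore] -/
theorem continuousOn_hzmap_symm : ContinuousOn (hzmap g k n c).symm (hzmap g k n c).target := by
  show ContinuousOn (hinv k n c) (hfun g k n c '' ball 0 1)
  -- on the target the height parameter lies in `(0, 1)`
  have hpar : ∀ w ∈ ball (0 : Fin (n + 1) → ℝ) 1, lpar k (hfun g k n c w) = hgt n w := by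
    intro w _
    simp [lpar, hfun, emb_height]
  have hcpar : Continuous (lpar k : E × E × ℝ → ℝ) := by unfold lpar; fun_prop
  -- the base point recovered on the target
  have hbase : ∀ w ∈ ball (0 : Fin (n + 1) → ℝ) 1,
      (lpar k (hfun g k n c w) * (1 - lpar k (hfun g k n c w)))⁻¹ • (hfun g k n c w).2.1 =
        chart n c (Fin.init w) := by
    intro w hw
    obtain ⟨-, hs⟩ := init_mem_ball_and_hgt n hw
    have hne : hgt n w * (1 - hgt n w) ≠ 0 := mul_ne_zero hs.1.ne' (by linarith [hs.2])
    rw [hpar w hw]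
    simp only [hfun, emb]
    rw [smul_smul, inv_mul_cancel₀ hne, one_smul]
  -- continuity of the base-point formula on the target
  have h1 : ContinuousOn (fun p : E × E × ℝ => (lpar k p * (1 - lpar k p))⁻¹ • p.2.1)
      (hfun g k n c '' ball 0 1) := by
    refine ContinuousOn.smul (ContinuousOn.inv₀ ?_ ?_) (continuous_fst.comp continuous_snd).continuousOn
    · exact (hcpar.mul (continuous_const.sub hcpar)).continuousOn
    · rintro _ ⟨w, hw, rfl⟩
      obtain ⟨-, hs⟩ := init_mem_ball_and_hgt n hw
      rw [hpar w hw]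
      exact mul_ne_zero hs.1.ne' (by linarith [hs.2])
  have h2 : ContinuousOn (fun p : E × E × ℝ => (RelCWComplex.map n c).symm
      (CWTransfer.toSubtype (RelCWComplex.map n c 0) ((lpar k p * (1 - lpar k p))⁻¹ • p.2.1)))
      (hfun g k n c '' ball 0 1) := by
    refine (RelCWComplex.continuousOn_symm n c).comp
      (((CWTransfer.continuousOn_toSubtype _).comp h1 ?_)) ?_
    · rintro _ ⟨w, hw, rfl⟩
      show (lpar k (hfun g k n c w) * (1 - lpar k (hfun g k n c w)))⁻¹ • (hfun g k n c w).2.1 ∈ K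
      rw [hbase w hw]
      exact chart_mem n c _
    · rintro _ ⟨w, hw, rfl⟩
      show CWTransfer.toSubtype _ _ ∈ (RelCWComplex.map n c).target
      rw [hbase w hw, toSubtype_chart]
      exact (RelCWComplex.map n c).map_source
        (by rw [RelCWComplex.source_eq]; exact (init_mem_ball_and_hgt n hw).1)
  exact h2.finSnoc ((continuous_const.mul hcpar).sub continuous_const).continuousOn

/-- Images of the horizontal cell map in product form: for `A = init ⁻¹ A₁ ∩ hgt ⁻¹ A₂` with
`A₁`, `A₂` arbitrary, `hfun '' A = emb g k '' (Φ_c(A₁) × A₂)`. [folklore] -/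
theorem image_hzmap_eq (A₁ : Set (Fin n → ℝ)) (A₂ : Set ℝ) :
    hzmap g k n c '' {w | (Fin.init w : Fin n → ℝ) ∈ A₁ ∧ hgt n w ∈ A₂} =
      (fun q : E × ℝ => emb g k q.1 q.2) '' ((chart n c '' A₁) ×ˢ A₂) := by
  ext p
  simp only [mem_image, mem_setOf_eq, mem_prod, hzmap_apply, Prod.exists]
  constructor
  · rintro ⟨w, ⟨h1, h2⟩, rfl⟩
    exact ⟨chart n c (Fin.init w), hgt n w, ⟨⟨Fin.init w, h1, rfl⟩, h2⟩, rfl⟩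
  · rintro ⟨x, s, ⟨⟨v, hv, rfl⟩, hs⟩, rfl⟩
    refine ⟨Fin.snoc v (2 * s - 1), ⟨by rwa [Fin.init_snoc], ?_⟩, ?_⟩
    · simp only [hgt, Fin.snoc_last]
      convert hs using 1
      ring
    · simp only [Fin.init_snoc, hgt, Fin.snoc_last]
      congr 1
      ring

/-- The closed ball of `Fin (n + 1) → ℝ` in product form. [folklore] -/
theorem closedBall_eq_setOf : closedBall (0 : Fin (n + 1) → ℝ) 1 =
    {w | (Fin.init w : Fin n → ℝ) ∈ closedBall (0 : Fin n → ℝ) 1 ∧ hgt n w ∈ Icc (0 : ℝ) 1} := by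
  ext w
  simp only [mem_setOf_eq, mem_closedBall_zero_iff, norm_eq_max_init_last w, max_le_iff, hgt,
    mem_Icc, Real.norm_eq_abs, abs_le]
  constructor
  · rintro ⟨h1, h2, h3⟩
    exact ⟨h1, by linarith, by linarith⟩
  · rintro ⟨h1, h2, h3⟩
    exact ⟨h1, by linarith, by linarith⟩

/-- The open ball of `Fin (n + 1) → ℝ` in product form. [folklore] -/
theorem ball_eq_setOf : ball (0 : Fin (n + 1) → ℝ) 1 =
    {w | (Fin.init w : Fin n → ℝ) ∈ ball (0 : Fin n → ℝ) 1 ∧ hgt n w ∈ Ioo (0 : ℝ) 1} := by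
  ext w
  simp only [mem_setOf_eq, mem_ball_zero_iff, norm_eq_max_init_last w, max_lt_iff, hgt,
    mem_Ioo, Real.norm_eq_abs, abs_lt]
  constructor
  · rintro ⟨h1, h2, h3⟩
    exact ⟨h1, by linarith, by linarith⟩
  · rintro ⟨h1, h2, h3⟩
    exact ⟨h1, by linarith, by linarith⟩

/-- **The closed horizontal cell** is the cylinder piece over the closed cell of `c`:
`emb g k '' (Φ_c(closedBall) × [0, 1])`. [folklore] -/
theorem image_hzmap_closedBall : hzmap g k n c '' closedBall 0 1 =
    (fun q : E × ℝ => emb g k q.1 q.2) '' ((chart n c '' closedBall 0 1) ×ˢ Icc 0 1) := by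
  rw [closedBall_eq_setOf, image_hzmap_eq]

/-- **The open horizontal cell** is `emb g k '' (Φ_c(ball) × (0, 1))`. [folklore] -/
theorem image_hzmap_ball : hzmap g k n c '' ball 0 1 =
    (fun q : E × ℝ => emb g k q.1 q.2) '' ((chart n c '' ball 0 1) ×ˢ Ioo 0 1) := by
  rw [ball_eq_setOf, image_hzmap_eq]

/-- **The boundary of a horizontal cell**: a point of the sphere has either `init` on the
sphere, or height `0`, or height `1`. [folklore] -/
theorem sphere_cases {w : Fin (n + 1) → ℝ} (hw : w ∈ sphere (0 : Fin (n + 1) → ℝ) 1) :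
    ((Fin.init w : Fin n → ℝ) ∈ sphere (0 : Fin n → ℝ) 1 ∧ hgt n w ∈ Icc (0 : ℝ) 1) ∨
      ((Fin.init w : Fin n → ℝ) ∈ closedBall (0 : Fin n → ℝ) 1 ∧ (hgt n w = 0 ∨ hgt n w = 1)) := by
  have hw' : ‖w‖ = 1 := mem_sphere_zero_iff_norm.1 hw
  obtain ⟨h1, h2⟩ := init_mem_closedBall_and_hgt n (sphere_subset_closedBall hw)
  rcases eq_or_lt_of_le (norm_init_le w) with h | h
  · left
    exact ⟨mem_sphere_zero_iff_norm.2 (h.trans hw'), h2⟩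
  · right
    refine ⟨h1, ?_⟩
    have h3 : ‖w (Fin.last n)‖ = 1 := by
      rw [norm_eq_max_init_last] at h hw'
      rcases lt_max_iff.1 h with h4 | h4
      · exact absurd h4 (lt_irrefl _)
      · rwa [max_eq_right h4.le] at hw'
    rw [Real.norm_eq_abs, abs_eq (zero_le_one)] at h3
    simp only [hgt]
    rcases h3 with h3 | h3
    · right; rw [h3]; norm_num
    · left; rw [h3]; norm_num

end Horizontal

end Telescope

end Literature.AlgebraicTopology.Homotopy

end
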